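import Mathlib
import HarnessLib
import Literature.MathematicalPhysics.QuantumLattice.HubbardUVSymbolFibreSampling
import Literature.MathematicalPhysics.QuantumLattice.HubbardUVGridPieceMoment

/-!
# The telescoping PIECES of the scale-`0` covariance symbol of a framed band: fibrewise bounds of the bare piece `Ψ(ω, b(q⃗))` and of
# an increment `Ψ(ω, v + w) − Ψ(ω, v)`, and their first SPACE moments, uniform in `M`, `β`, `L`

Topic `MathematicalPhysics/QuantumLattice`; continues `HubbardUVSymbolFibreSampling` (fibrewise envelopes of `Ψ`, `∂_eΨ`, `Ψ(·+δe₀) − Ψ`,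
`∂_e(Ψ(·+δe₀) − Ψ)`; sampled composition / increment bounds) and `HubbardUVGridPieceMoment` (compact `ℓ²` majorants `uvPieceSq` and
the normalised space moment `uvSpaceMomentConst` of an abstract piece).  For the covariance `C^K_{>Λ}` of a band
`e_K = ε − μ − Σₘ Kₘ` framed by pieces `Kₘ` (Benfatto–Giuliani–Mastropietro 2006, §3 (3.2)–(3.8): the symbol is telescoped along the
partial frames `bₘ = ε − μ − Σ_{n≤m} Kₙ`), the two kinds of pieces are
(i) the BARE piece `G_b` (band `b` with `‖Dⁱb̃‖ ≤ Dⁱ`, `1 ≤ i ≤ 3`), and (ii) the INCREMENT `G_{v+w} − G_v` (`‖Dⁱ(ṽ + s·w̃)‖ ≤ Dⁱ` for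
`s ∈ [0,1]`, `‖Dⁱw̃‖ ≤ Wᵢ`, `i ≤ 3`).  With `Ψ = uvSymbol₂ (βL²) Λ`, `Λ ≤ 4`, cutoff derivatives `≤ B` up to order `5`:

* `uvBaseQ`, `uvBaseQ'`, `uvIncrQ`, `uvIncrQ'` — the value / one-Matsubara-step amplitudes of the two kinds of pieces;
* **`basePiece_value_le`**, **`basePiece_step_le`**, **`incrPiece_value_le`**, **`incrPiece_step_le`** — the fibrewise hypotheses `(V)`,
  `(D)` of `HubbardUVGridPieceMoment` for the two kinds of pieces;
* **`spaceMoment_basePiece_le`**, **`spaceMoment_incrPiece_le`** — `(β/N)·Σ_{a,b⃗} |b̃_l|·‖S[P](a,b⃗)‖ ≤ uvSpaceMomentConst Λ R (uvPieceSq …)`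
  (`2 ≤ β`, `β³ ≤ M`, `2M ≤ N`, `R ≥ 1`, `l ≠ l'`).

Everything is proved; the four amplitude tables are the only definitions; no named facts.

## Sources

G. Benfatto, A. Giuliani, V. Mastropietro, Ann. Henri Poincaré 7 (2006) 809–898, §2.1 Lemma 2.2, (2.36aa), §2.8 (2.80)–(2.81),
§3 (3.2)–(3.8) (`BenfattoGiulianiMastropietro2006`); M. Salmhofer, *Renormalization* (1999), §4.2.5 (4.70) (`Salmhofer1999`).
-/

noncomputable section

namespace Literature.MathematicalPhysics.QuantumLattice

open Literature.Probability.LatticeModels Finset Complex Set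
open scoped Nat

variable {L M N : ℕ}

/-! ### §1 The amplitude tables -/

/-- Value amplitude of the bare piece: `B·(k+1)!·(4/Λ)ᵏ·(k!·Dᵏ)`. [cite: BenfattoGiulianiMastropietro2006, (2.36aa)] -/
def uvBaseQ (B Λ D : ℝ) (k : ℕ) : ℝ := B * (k + 1) ! * (4 / Λ) ^ k * (k ! * D ^ k)

/-- One-step amplitude of the bare piece: `B·(k+2)!·(4/Λ)^{k+1}·(k!·Dᵏ)`. [cite: BenfattoGiulianiMastropietro2006, (2.36aa)] -/
def uvBaseQ' (B Λ D : ℝ) (k : ℕ) : ℝ := B * (k + 2) ! * (4 / Λ) ^ (k + 1) * (k ! * D ^ k)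

/-- Value amplitude of an increment: `B·(k+2)!·(4/Λ)^{k+1}·Σ_{j≤k} C(k,j)·j!·Dʲ·W_{k-j}`. [cite: BenfattoGiulianiMastropietro2006, §3 (3.2)] -/
def uvIncrQ (B Λ D : ℝ) (W : ℕ → ℝ) (k : ℕ) : ℝ :=
  B * (k + 2) ! * (4 / Λ) ^ (k + 1) * ∑ j ∈ Finset.range (k + 1), (k.choose j : ℝ) * j ! * D ^ j * W (k - j)

/-- One-step amplitude of an increment: `B·(k+3)!·(4/Λ)^{k+2}·Σ_{j≤k} C(k,j)·j!·Dʲ·W_{k-j}`. [cite: BenfattoGiulianiMastropietro2006, §3 (3.2)] -/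
def uvIncrQ' (B Λ D : ℝ) (W : ℕ → ℝ) (k : ℕ) : ℝ :=
  B * (k + 3) ! * (4 / Λ) ^ (k + 2) * ∑ j ∈ Finset.range (k + 1), (k.choose j : ℝ) * j ! * D ^ j * W (k - j)

/-! ### §2 Fibrewise bounds of the bare piece -/

section Base

variable [NeZero L] {β Λ : ℝ} {Ncut : ℕ} {B : ℝ}

/-- **(V) for the bare piece**: `‖Δ_{e_l}^aΔ_{e_{l'}}^b[Ψ(ω, b(·))](q⃗)‖ ≤ (2π/L)ᵏ·βL²·uvBaseQ(k)·2/max(|ω|,Λ/2)` (`k = a+b ≤ 3 ≤ Ncut`).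
[cite: BenfattoGiulianiMastropietro2006, (2.36aa)] -/
theorem basePiece_value_le (hβ : 0 < β) (hΛ : 0 < Λ) (hΛ4 : Λ ≤ 4) (hB1 : 1 ≤ B)
    (hB : ∀ i ≤ Ncut, ∀ t, ‖iteratedDeriv i salmhoferCutoff t‖ ≤ B) (hN : 5 ≤ Ncut)
    {bt : EuclideanSpace ℝ (Fin 2) → ℝ} (hbt : ContDiff ℝ 3 bt)
    (hper : ∀ (p : Fin 2 → ℝ) (z : Fin 2 → ℤ), bt (WithLp.toLp 2 (fun i => p i + z i * (2 * Real.pi))) = bt (WithLp.toLp 2 p))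
    {D : ℝ} (hD : ∀ i, 1 ≤ i → i ≤ 3 → ∀ x, ‖iteratedFDeriv ℝ i bt x‖ ≤ D ^ i) {a b : ℕ} (hab : a + b ≤ 3)
    (l l' : Fin 2) (ω : ℝ) (qv : TorusSite 2 L) :
    ‖(fwdDiff (Pi.single l (1 : ZMod L) : TorusSite 2 L))^[a] ((fwdDiff (Pi.single l' (1 : ZMod L) : TorusSite 2 L))^[b]
        (fun y => uvSymbol₂ (β * (L : ℝ) ^ 2) Λ (fbPt ω (bt (WithLp.toLp 2 (latticeMomentum L y)))))) qv‖ ≤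
      (2 * Real.pi / L) ^ (a + b) * (β * (L : ℝ) ^ 2 * uvBaseQ B Λ D (a + b)) * (2 / max |ω| (Λ / 2)) := by
  have hc : 0 ≤ β * (L : ℝ) ^ 2 := by positivity
  have hG := fibreEnvBound_uvSymbol₂ hc hΛ hΛ4 hB1 hB (k := a + b) (by omega)
  have h := norm_fwdDiff_iter₂_comp_sample_le (L := L) (contDiff_uvSymbol₂ _ hΛ) hG
    (hbt.of_le (by exact_mod_cast hab)) hper (fun i hi1 hi3 x => hD i hi1 (hi3.trans hab) x) ω l l' qv
  refine h.trans (le_of_eq ?_)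
  rw [sub_zero, uvBaseQ]
  ring

/-- **(D) for the bare piece** (one Matsubara step `δ = 2π/β`):
`‖Δ^aΔ^b[Ψ(ω+δ, b(·))](q⃗) − Δ^aΔ^b[Ψ(ω, b(·))](q⃗)‖ ≤ (2π/L)ᵏ·(2π/β)·βL²·uvBaseQ′(k)·2/max(|ω| − 2π/β, Λ/2)`.
[cite: BenfattoGiulianiMastropietro2006, Lemma 2.2 and (2.36aa)] -/
theorem basePiece_step_le (hβ : 0 < β) (hΛ : 0 < Λ) (hΛ4 : Λ ≤ 4) (hB1 : 1 ≤ B)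
    (hB : ∀ i ≤ Ncut, ∀ t, ‖iteratedDeriv i salmhoferCutoff t‖ ≤ B) (hN : 5 ≤ Ncut)
    {bt : EuclideanSpace ℝ (Fin 2) → ℝ} (hbt : ContDiff ℝ 3 bt)
    (hper : ∀ (p : Fin 2 → ℝ) (z : Fin 2 → ℤ), bt (WithLp.toLp 2 (fun i => p i + z i * (2 * Real.pi))) = bt (WithLp.toLp 2 p))
    {D : ℝ} (hD : ∀ i, 1 ≤ i → i ≤ 3 → ∀ x, ‖iteratedFDeriv ℝ i bt x‖ ≤ D ^ i) {a b : ℕ} (hab : a + b ≤ 3)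
    (l l' : Fin 2) (ω : ℝ) (qv : TorusSite 2 L) :
    ‖(fwdDiff (Pi.single l (1 : ZMod L) : TorusSite 2 L))^[a] ((fwdDiff (Pi.single l' (1 : ZMod L) : TorusSite 2 L))^[b]
          (fun y => uvSymbol₂ (β * (L : ℝ) ^ 2) Λ (fbPt (ω + 2 * Real.pi / β) (bt (WithLp.toLp 2 (latticeMomentum L y)))))) qv -
        (fwdDiff (Pi.single l (1 : ZMod L) : TorusSite 2 L))^[a] ((fwdDiff (Pi.single l' (1 : ZMod L) : TorusSite 2 L))^[b]
          (fun y => uvSymbol₂ (β * (L : ℝ) ^ 2) Λ (fbPt ω (bt (WithLp.toLp 2 (latticeMomentum L y)))))) qv‖ ≤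
      (2 * Real.pi / L) ^ (a + b) * (2 * Real.pi / β * (β * (L : ℝ) ^ 2 * uvBaseQ' B Λ D (a + b))) *
        (2 / max (|ω| - 2 * Real.pi / β) (Λ / 2)) := by
  have hc : 0 ≤ β * (L : ℝ) ^ 2 := by positivity
  set δ : ℝ := 2 * Real.pi / β with hδ
  have hδ0 : 0 < δ := by positivity
  have hG := fibreEnvBound_fbShiftSub_uvSymbol₂ hc hΛ hΛ4 hB1 hB (k := a + b) (by omega) δ
  rw [abs_of_pos hδ0] at hG
  have hfun : (fun y : TorusSite 2 L => uvSymbol₂ (β * (L : ℝ) ^ 2) Λ (fbPt (ω + δ) (bt (WithLp.toLp 2 (latticeMomentum L y))))) -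
      (fun y => uvSymbol₂ (β * (L : ℝ) ^ 2) Λ (fbPt ω (bt (WithLp.toLp 2 (latticeMomentum L y))))) =
      fun y => fbShiftSub (uvSymbol₂ (β * (L : ℝ) ^ 2) Λ) δ (fbPt ω (bt (WithLp.toLp 2 (latticeMomentum L y)))) := by
    funext y; simp only [Pi.sub_apply, fbShiftSub_fbPt]
  rw [← fwdDiff_iter₂_sub, hfun]
  have h := norm_fwdDiff_iter₂_comp_sample_le (L := L) (contDiff_fbShiftSub (contDiff_uvSymbol₂ _ hΛ) δ) hG
    (hbt.of_le (by exact_mod_cast hab)) hper (fun i hi1 hi3 x => hD i hi1 (hi3.trans hab) x) ω l l' qv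
  refine h.trans (le_of_eq ?_)
  rw [uvBaseQ']
  ring

end Base

/-! ### §3 Fibrewise bounds of an increment -/

section Incr

variable [NeZero L] {β Λ : ℝ} {Ncut : ℕ} {B : ℝ}

/-- **(V) for an increment**: `‖Δ^aΔ^b[Ψ(ω, v + w)](q⃗) − Δ^aΔ^b[Ψ(ω, v)](q⃗)‖ ≤ (2π/L)ᵏ·βL²·uvIncrQ(k)·2/max(|ω|,Λ/2)` (`k = a + b ≤ 3`).
[cite: BenfattoGiulianiMastropietro2006, §3 (3.2)–(3.8)] -/
theorem incrPiece_value_le (hβ : 0 < β) (hΛ : 0 < Λ) (hΛ4 : Λ ≤ 4) (hB1 : 1 ≤ B)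
    (hB : ∀ i ≤ Ncut, ∀ t, ‖iteratedDeriv i salmhoferCutoff t‖ ≤ B) (hN : 5 ≤ Ncut)
    {vt wt : EuclideanSpace ℝ (Fin 2) → ℝ} (hvt : ContDiff ℝ 3 vt) (hwt : ContDiff ℝ 3 wt)
    (hperv : ∀ (p : Fin 2 → ℝ) (z : Fin 2 → ℤ), vt (WithLp.toLp 2 (fun i => p i + z i * (2 * Real.pi))) = vt (WithLp.toLp 2 p))
    (hperw : ∀ (p : Fin 2 → ℝ) (z : Fin 2 → ℤ), wt (WithLp.toLp 2 (fun i => p i + z i * (2 * Real.pi))) = wt (WithLp.toLp 2 p))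
    {D : ℝ} (hD : ∀ s ∈ Icc (0 : ℝ) 1, ∀ i, 1 ≤ i → i ≤ 3 → ∀ x, ‖iteratedFDeriv ℝ i (fun x => vt x + s * wt x) x‖ ≤ D ^ i)
    {W : ℕ → ℝ} (hW : ∀ i ≤ 3, ∀ x, ‖iteratedFDeriv ℝ i wt x‖ ≤ W i) {a b : ℕ} (hab : a + b ≤ 3)
    (l l' : Fin 2) (ω : ℝ) (qv : TorusSite 2 L) :
    ‖(fwdDiff (Pi.single l (1 : ZMod L) : TorusSite 2 L))^[a] ((fwdDiff (Pi.single l' (1 : ZMod L) : TorusSite 2 L))^[b]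
          (fun y => uvSymbol₂ (β * (L : ℝ) ^ 2) Λ (fbPt ω (vt (WithLp.toLp 2 (latticeMomentum L y)) +
            wt (WithLp.toLp 2 (latticeMomentum L y)))))) qv -
        (fwdDiff (Pi.single l (1 : ZMod L) : TorusSite 2 L))^[a] ((fwdDiff (Pi.single l' (1 : ZMod L) : TorusSite 2 L))^[b]
          (fun y => uvSymbol₂ (β * (L : ℝ) ^ 2) Λ (fbPt ω (vt (WithLp.toLp 2 (latticeMomentum L y)))))) qv‖ ≤
      (2 * Real.pi / L) ^ (a + b) * (β * (L : ℝ) ^ 2 * uvIncrQ B Λ D W (a + b)) * (2 / max |ω| (Λ / 2)) := by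
  have hc : 0 ≤ β * (L : ℝ) ^ 2 := by positivity
  have hG := fibreEnvBound_fbDir_uvSymbol₂ hc hΛ hΛ4 hB1 hB (k := a + b) (by omega) fbE1
  rw [norm_fbE1, one_mul] at hG
  have h := norm_fwdDiff_iter₂_increment_sample_le (L := L) hΛ (contDiff_uvSymbol₂ _ hΛ) hG
    (hvt.of_le (by exact_mod_cast hab)) (hwt.of_le (by exact_mod_cast hab)) hperv hperw
    (fun s hs i hi1 hi3 x => hD s hs i hi1 (hi3.trans hab) x) (fun i hi x => hW i (hi.trans hab) x) ω l l' qv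
  refine h.trans (le_of_eq ?_)
  rw [sub_zero, uvIncrQ]
  ring

/-- **(D) for an increment** (one Matsubara step `δ = 2π/β`): the time-differenced increment is the increment of `Ψ(·+δe₀) − Ψ`, so
`‖[Δ^aΔ^b Φ(ω+δ) − Δ^aΔ^b Φ(ω)](q⃗)‖ ≤ (2π/L)ᵏ·(2π/β)·βL²·uvIncrQ′(k)·2/max(|ω| − 2π/β, Λ/2)` for `Φ(ω) = Ψ(ω, v + w) − Ψ(ω, v)`.
[cite: BenfattoGiulianiMastropietro2006, Lemma 2.2 and §3 (3.2)–(3.8)] -/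
theorem incrPiece_step_le (hβ : 0 < β) (hΛ : 0 < Λ) (hΛ4 : Λ ≤ 4) (hB1 : 1 ≤ B)
    (hB : ∀ i ≤ Ncut, ∀ t, ‖iteratedDeriv i salmhoferCutoff t‖ ≤ B) (hN : 5 ≤ Ncut)
    {vt wt : EuclideanSpace ℝ (Fin 2) → ℝ} (hvt : ContDiff ℝ 3 vt) (hwt : ContDiff ℝ 3 wt)
    (hperv : ∀ (p : Fin 2 → ℝ) (z : Fin 2 → ℤ), vt (WithLp.toLp 2 (fun i => p i + z i * (2 * Real.pi))) = vt (WithLp.toLp 2 p))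
    (hperw : ∀ (p : Fin 2 → ℝ) (z : Fin 2 → ℤ), wt (WithLp.toLp 2 (fun i => p i + z i * (2 * Real.pi))) = wt (WithLp.toLp 2 p))
    {D : ℝ} (hD : ∀ s ∈ Icc (0 : ℝ) 1, ∀ i, 1 ≤ i → i ≤ 3 → ∀ x, ‖iteratedFDeriv ℝ i (fun x => vt x + s * wt x) x‖ ≤ D ^ i)
    {W : ℕ → ℝ} (hW : ∀ i ≤ 3, ∀ x, ‖iteratedFDeriv ℝ i wt x‖ ≤ W i) {a b : ℕ} (hab : a + b ≤ 3)
    (l l' : Fin 2) (ω : ℝ) (qv : TorusSite 2 L) :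
    ‖((fwdDiff (Pi.single l (1 : ZMod L) : TorusSite 2 L))^[a] ((fwdDiff (Pi.single l' (1 : ZMod L) : TorusSite 2 L))^[b]
          (fun y => uvSymbol₂ (β * (L : ℝ) ^ 2) Λ (fbPt (ω + 2 * Real.pi / β) (vt (WithLp.toLp 2 (latticeMomentum L y)) +
              wt (WithLp.toLp 2 (latticeMomentum L y)))) -
            uvSymbol₂ (β * (L : ℝ) ^ 2) Λ (fbPt (ω + 2 * Real.pi / β) (vt (WithLp.toLp 2 (latticeMomentum L y)))))) qv -
        (fwdDiff (Pi.single l (1 : ZMod L) : TorusSite 2 L))^[a] ((fwdDiff (Pi.single l' (1 : ZMod L) : TorusSite 2 L))^[b]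
          (fun y => uvSymbol₂ (β * (L : ℝ) ^ 2) Λ (fbPt ω (vt (WithLp.toLp 2 (latticeMomentum L y)) +
              wt (WithLp.toLp 2 (latticeMomentum L y)))) -
            uvSymbol₂ (β * (L : ℝ) ^ 2) Λ (fbPt ω (vt (WithLp.toLp 2 (latticeMomentum L y)))))) qv)‖ ≤
      (2 * Real.pi / L) ^ (a + b) * (2 * Real.pi / β * (β * (L : ℝ) ^ 2 * uvIncrQ' B Λ D W (a + b))) *
        (2 / max (|ω| - 2 * Real.pi / β) (Λ / 2)) := by
  have hc : 0 ≤ β * (L : ℝ) ^ 2 := by positivity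
  set δ : ℝ := 2 * Real.pi / β with hδ
  have hδ0 : 0 < δ := by positivity
  set Ψ := uvSymbol₂ (β * (L : ℝ) ^ 2) Λ with hΨ
  set g := fbShiftSub Ψ δ with hg
  have hG := fibreEnvBound_fbDir_fbShiftSub_uvSymbol₂ hc hΛ hΛ4 hB1 hB (k := a + b) (by omega) δ fbE1
  rw [norm_fbE1, mul_one, abs_of_pos hδ0, ← hΨ, ← hg] at hG
  -- the time-differenced increment is the increment of `g = Ψ(·+δe₀) − Ψ`
  set P : TorusSite 2 L → EuclideanSpace ℝ (Fin 2) := fun y => WithLp.toLp 2 (latticeMomentum L y) with hPdef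
  have hfun : ((fun y : TorusSite 2 L => Ψ (fbPt (ω + δ) (vt (P y) + wt (P y))) - Ψ (fbPt (ω + δ) (vt (P y)))) -
      fun y => Ψ (fbPt ω (vt (P y) + wt (P y))) - Ψ (fbPt ω (vt (P y)))) =
      (fun y => g (fbPt ω (vt (P y) + wt (P y)))) - fun y => g (fbPt ω (vt (P y))) := by
    funext y; simp only [Pi.sub_apply, hg, fbShiftSub_fbPt]; ring
  rw [← fwdDiff_iter₂_sub, hfun, fwdDiff_iter₂_sub]
  have hgc : ContDiff ℝ (((a + b : ℕ) : ℕ∞) + 1) g := contDiff_fbShiftSub (contDiff_uvSymbol₂ _ hΛ) δ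
  have h := norm_fwdDiff_iter₂_increment_sample_le (L := L) hΛ hgc hG
    (hvt.of_le (by exact_mod_cast hab)) (hwt.of_le (by exact_mod_cast hab)) hperv hperw
    (fun s hs i hi1 hi3 x => hD s hs i hi1 (hi3.trans hab) x) (fun i hi x => hW i (hi.trans hab) x) ω l l' qv
  refine h.trans (le_of_eq ?_)
  rw [uvIncrQ']
  ring

end Incr

/-! ### §4 The first space moments of the two kinds of pieces -/

section Moments

variable [NeZero L] [NeZero N] {β Λ : ℝ} {Ncut : ℕ} {B : ℝ}

/-- `(Δ_u)⁰ f = f`: the `t = 0` row of the compact table. [cite: BenfattoGiulianiMastropietro2006, (2.36aa)] -/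
theorem compactTable_of_rows (P : TorusSite 1 N → TorusSite 2 L → ℂ) (Kq : ℕ → ℕ → ℝ) (l l' : Fin 2)
    (h0 : ∀ a b : ℕ, 1 ≤ a + b → a + b ≤ 3 →
      ∑ p : TorusSite 1 N, ∑ p' : TorusSite 2 L,
          ‖(fwdDiff (Pi.single l (1 : ZMod L) : TorusSite 2 L))^[a]
            ((fwdDiff (Pi.single l' (1 : ZMod L) : TorusSite 2 L))^[b] (P p)) p'‖ ^ 2 ≤
        Kq 0 (a + b) / ((L : ℝ) ^ (2 * (a + b) + 2) * β ^ (2 * 0 + 1)))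
    (h1 : ∀ a b : ℕ, 1 ≤ a + b → a + b ≤ 3 →
      ∑ p : TorusSite 1 N, ∑ p' : TorusSite 2 L,
          ‖(fwdDiff (fun _ : Fin 1 => (1 : ZMod N)))^[1]
            (fun q => (fwdDiff (Pi.single l (1 : ZMod L) : TorusSite 2 L))^[a]
              ((fwdDiff (Pi.single l' (1 : ZMod L) : TorusSite 2 L))^[b] (P q)) p') p‖ ^ 2 ≤
        Kq 1 (a + b) / ((L : ℝ) ^ (2 * (a + b) + 2) * β ^ (2 * 1 + 1))) :
    ∀ (t a b : ℕ), t ≤ 1 → 1 ≤ a + b → a + b ≤ 3 →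
      ∑ p : TorusSite 1 N, ∑ p' : TorusSite 2 L,
          ‖(fwdDiff (fun _ : Fin 1 => (1 : ZMod N)))^[t]
            (fun q => (fwdDiff (Pi.single l (1 : ZMod L) : TorusSite 2 L))^[a]
              ((fwdDiff (Pi.single l' (1 : ZMod L) : TorusSite 2 L))^[b] (P q)) p') p‖ ^ 2 ≤
        Kq t (a + b) / ((L : ℝ) ^ (2 * (a + b) + 2) * β ^ (2 * t + 1)) := by
  intro t a b ht hab1 hab3
  interval_cases t
  · simpa only [Function.iterate_zero, id_eq] using h0 a b hab1 hab3
  · exact h1 a b hab1 hab3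

/-- **The first space moment of the BARE piece** `G_b = uvGridSymbolBand L M N β Λ (b̃∘p)`:
`(β/N)·Σ_{a,b⃗} |b̃_l|·‖S[G_b](a,b⃗)‖ ≤ uvSpaceMomentConst Λ R (uvPieceSq Λ (uvBaseQ B Λ D) (uvBaseQ′ B Λ D))`.
[cite: BenfattoGiulianiMastropietro2006, §2.8 (2.80)–(2.81) and §3 (3.2)] -/
theorem spaceMoment_basePiece_le (hβ2 : 2 ≤ β) (hΛ : 0 < Λ) (hΛ4 : Λ ≤ 4) (hβM : β ^ 3 ≤ (M : ℝ)) (hMN : 2 * M ≤ N) (hB1 : 1 ≤ B)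
    (hB : ∀ i ≤ Ncut, ∀ t, ‖iteratedDeriv i salmhoferCutoff t‖ ≤ B) (hN : 5 ≤ Ncut)
    {bt : EuclideanSpace ℝ (Fin 2) → ℝ} (hbt : ContDiff ℝ 3 bt)
    (hper : ∀ (p : Fin 2 → ℝ) (z : Fin 2 → ℤ), bt (WithLp.toLp 2 (fun i => p i + z i * (2 * Real.pi))) = bt (WithLp.toLp 2 p))
    {D : ℝ} (hD : ∀ i, 1 ≤ i → i ≤ 3 → ∀ x, ‖iteratedFDeriv ℝ i bt x‖ ≤ D ^ i) {l l' : Fin 2} (hll' : l ≠ l') {R : ℕ} (hR : 1 ≤ R) :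
    β / N * ∑ a : TorusSite 1 N, ∑ bv : TorusSite 2 L,
        |(((bv l).valMinAbs : ℤ) : ℝ)| *
          ‖∑ q₀ : TorusSite 1 N, ∑ qv : TorusSite 2 L, torusChar q₀ a * torusChar qv bv *
            uvGridSymbolBand L M N β Λ (fun y => bt (WithLp.toLp 2 (latticeMomentum L y))) q₀ qv‖ ≤
      uvSpaceMomentConst Λ R (uvPieceSq Λ (uvBaseQ B Λ D) (uvBaseQ' B Λ D)) := by
  obtain ⟨hβ, hM1, h8, hMN'⟩ := thresholds_aux hβ2 hβM hMN
  set Φ : ℝ → TorusSite 2 L → ℂ := fun ω y => uvSymbol₂ (β * (L : ℝ) ^ 2) Λ (fbPt ω (bt (WithLp.toLp 2 (latticeMomentum L y))))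
    with hΦ
  set P := uvGridSymbolBand L M N β Λ (fun y => bt (WithLp.toLp 2 (latticeMomentum L y))) with hPdef
  have hP : ∀ q₀ qv, P q₀ qv = if (q₀ 0).val < 2 * M then ((1 / (β * (L : ℝ) ^ 2) : ℝ) : ℂ) ^ 2 * Φ (gridFreq M N β q₀) qv else 0 :=
    fun q₀ qv => rfl
  refine spaceMoment_charSum_piece_le hβ2 hΛ hβM hMN P _ (uvPieceSq_nonneg hΛ _ _) hll' ?_ hR
  refine compactTable_of_rows P _ l l' (fun a b _ hab3 => ?_) (fun a b _ hab3 => ?_)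
  · exact sum_norm_sq_spaceDiff_piece_le hβ hΛ hMN Φ P hP _ _ _ _
      (fun ω qv => basePiece_value_le (L := L) hβ hΛ hΛ4 hB1 hB hN hbt hper hD hab3 l l' ω qv)
  · exact sum_norm_sq_timeDiff_spaceDiff_piece_le hβ2 hΛ hβM hMN Φ P hP _ _ _ _
      (fun ω qv => basePiece_value_le (L := L) hβ hΛ hΛ4 hB1 hB hN hbt hper hD hab3 l l' ω qv)
      (fun ω qv => basePiece_step_le (L := L) hβ hΛ hΛ4 hB1 hB hN hbt hper hD hab3 l l' ω qv)

/-- **The first space moment of an INCREMENT** `G_{v+w} − G_v`: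
`(β/N)·Σ_{a,b⃗} |b̃_l|·‖S[G_{v+w} − G_v](a,b⃗)‖ ≤ uvSpaceMomentConst Λ R (uvPieceSq Λ (uvIncrQ B Λ D W) (uvIncrQ′ B Λ D W))`.
[cite: BenfattoGiulianiMastropietro2006, §2.8 (2.80)–(2.81) and §3 (3.2)–(3.8)] -/
theorem spaceMoment_incrPiece_le (hβ2 : 2 ≤ β) (hΛ : 0 < Λ) (hΛ4 : Λ ≤ 4) (hβM : β ^ 3 ≤ (M : ℝ)) (hMN : 2 * M ≤ N) (hB1 : 1 ≤ B)
    (hB : ∀ i ≤ Ncut, ∀ t, ‖iteratedDeriv i salmhoferCutoff t‖ ≤ B) (hN : 5 ≤ Ncut)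
    {vt wt : EuclideanSpace ℝ (Fin 2) → ℝ} (hvt : ContDiff ℝ 3 vt) (hwt : ContDiff ℝ 3 wt)
    (hperv : ∀ (p : Fin 2 → ℝ) (z : Fin 2 → ℤ), vt (WithLp.toLp 2 (fun i => p i + z i * (2 * Real.pi))) = vt (WithLp.toLp 2 p))
    (hperw : ∀ (p : Fin 2 → ℝ) (z : Fin 2 → ℤ), wt (WithLp.toLp 2 (fun i => p i + z i * (2 * Real.pi))) = wt (WithLp.toLp 2 p))
    {D : ℝ} (hD : ∀ s ∈ Icc (0 : ℝ) 1, ∀ i, 1 ≤ i → i ≤ 3 → ∀ x, ‖iteratedFDeriv ℝ i (fun x => vt x + s * wt x) x‖ ≤ D ^ i)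
    {W : ℕ → ℝ} (hW : ∀ i ≤ 3, ∀ x, ‖iteratedFDeriv ℝ i wt x‖ ≤ W i) {l l' : Fin 2} (hll' : l ≠ l') {R : ℕ} (hR : 1 ≤ R) :
    β / N * ∑ a : TorusSite 1 N, ∑ bv : TorusSite 2 L,
        |(((bv l).valMinAbs : ℤ) : ℝ)| *
          ‖∑ q₀ : TorusSite 1 N, ∑ qv : TorusSite 2 L, torusChar q₀ a * torusChar qv bv *
            (uvGridSymbolBand L M N β Λ (fun y => vt (WithLp.toLp 2 (latticeMomentum L y)) + wt (WithLp.toLp 2 (latticeMomentum L y))) -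
              uvGridSymbolBand L M N β Λ (fun y => vt (WithLp.toLp 2 (latticeMomentum L y)))) q₀ qv‖ ≤
      uvSpaceMomentConst Λ R (uvPieceSq Λ (uvIncrQ B Λ D W) (uvIncrQ' B Λ D W)) := by
  obtain ⟨hβ, hM1, h8, hMN'⟩ := thresholds_aux hβ2 hβM hMN
  set Φ : ℝ → TorusSite 2 L → ℂ := fun ω y =>
    uvSymbol₂ (β * (L : ℝ) ^ 2) Λ (fbPt ω (vt (WithLp.toLp 2 (latticeMomentum L y)) + wt (WithLp.toLp 2 (latticeMomentum L y)))) -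
      uvSymbol₂ (β * (L : ℝ) ^ 2) Λ (fbPt ω (vt (WithLp.toLp 2 (latticeMomentum L y)))) with hΦ
  set P := uvGridSymbolBand L M N β Λ (fun y => vt (WithLp.toLp 2 (latticeMomentum L y)) + wt (WithLp.toLp 2 (latticeMomentum L y))) -
    uvGridSymbolBand L M N β Λ (fun y => vt (WithLp.toLp 2 (latticeMomentum L y))) with hPdef
  have hP : ∀ q₀ qv, P q₀ qv = if (q₀ 0).val < 2 * M then ((1 / (β * (L : ℝ) ^ 2) : ℝ) : ℂ) ^ 2 * Φ (gridFreq M N β q₀) qv else 0 := by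
    intro q₀ qv
    simp only [hPdef, Pi.sub_apply, uvGridSymbolBand, hΦ]
    split_ifs <;> ring
  -- the space differences of `Φ(ω)` are differences of those of the two composed symbols
  have hsub : ∀ (a b : ℕ) (ω : ℝ) (qv : TorusSite 2 L),
      (fwdDiff (Pi.single l (1 : ZMod L) : TorusSite 2 L))^[a] ((fwdDiff (Pi.single l' (1 : ZMod L) : TorusSite 2 L))^[b] (Φ ω)) qv =
        (fwdDiff (Pi.single l (1 : ZMod L) : TorusSite 2 L))^[a] ((fwdDiff (Pi.single l' (1 : ZMod L) : TorusSite 2 L))^[b]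
            (fun y => uvSymbol₂ (β * (L : ℝ) ^ 2) Λ (fbPt ω (vt (WithLp.toLp 2 (latticeMomentum L y)) +
              wt (WithLp.toLp 2 (latticeMomentum L y)))))) qv -
          (fwdDiff (Pi.single l (1 : ZMod L) : TorusSite 2 L))^[a] ((fwdDiff (Pi.single l' (1 : ZMod L) : TorusSite 2 L))^[b]
            (fun y => uvSymbol₂ (β * (L : ℝ) ^ 2) Λ (fbPt ω (vt (WithLp.toLp 2 (latticeMomentum L y)))))) qv := by
    intro a b ω qv
    rw [← fwdDiff_iter₂_sub]
    rfl
  refine spaceMoment_charSum_piece_le hβ2 hΛ hβM hMN P _ (uvPieceSq_nonneg hΛ _ _) hll' ?_ hR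
  refine compactTable_of_rows P _ l l' (fun a b _ hab3 => ?_) (fun a b _ hab3 => ?_)
  · exact sum_norm_sq_spaceDiff_piece_le hβ hΛ hMN Φ P hP _ _ _ _
      (fun ω qv => by
        rw [hsub]
        exact incrPiece_value_le (L := L) hβ hΛ hΛ4 hB1 hB hN hvt hwt hperv hperw hD hW hab3 l l' ω qv)
  · exact sum_norm_sq_timeDiff_spaceDiff_piece_le hβ2 hΛ hβM hMN Φ P hP _ _ _ _
      (fun ω qv => by
        rw [hsub]
        exact incrPiece_value_le (L := L) hβ hΛ hΛ4 hB1 hB hN hvt hwt hperv hperw hD hW hab3 l l' ω qv)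
      (fun ω qv => incrPiece_step_le (L := L) hβ hΛ hΛ4 hB1 hB hN hvt hwt hperv hperw hD hW hab3 l l' ω qv)

end Moments

end Literature.MathematicalPhysics.QuantumLattice

end
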